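import Literature.NumberTheory.LFunctions.WienerIkeharaKernel
import HarnessLib

/-!
# Wiener–Ikehara theorem, Tauberian step (Fejér means + monotonicity ⇒ convergence)

Topic `Literature/NumberTheory/LFunctions`. Second of four files proving `Literature.NumberTheory.LFunctions.WienerIkehara`
(Montgomery–Vaughan 2007, Cor. 8.8). This file contains the purely real-variable final step of the
classical Ikehara–Bochner–Landau proof: if `B : ℝ → ℝ` is non-negative, locally bounded above,
*slowly decreasing in the multiplicative sense* `B(v) ≥ e^{u−v} B(u)` for `u ≤ v` (which is what
`B(u) = e^{-u} A(e^u)` satisfies when `A` is non-decreasing), and its Fejér means converge,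

  `∫_ℝ B(u) K_λ(y − u) du → c ∫_ℝ K_1`   as `y → ∞`, for every `λ > 0`

(`K_λ(x) = 2λ sinc(λx)²`, see `WienerIkeharaKernel`), then `B(y) → c` as `y → ∞`.

## Proof sketch

For `δ > 0` put `k(λ, δ) = ∫_{-δ}^{δ} K_λ` and `κ = ∫_ℝ K_1 = ∫_ℝ K_λ`. Monotonicity gives on
`[y − δ, y + δ]`: `e^{-2δ} B(y − δ) ≤ B(u) ≤ e^{2δ} B(y + δ)`. Hence
`e^{-2δ} B(y−δ) k(λ,δ) ≤ Φ_λ(y)` (upper bound `limsup B ≤ c e^{2δ} κ / k(λ,δ)`), so `B` is bounded,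
say by `M`; and then `Φ_λ(y) ≤ e^{2δ} B(y+δ) k(λ,δ) + M (κ − k(λ,δ))` (lower bound). Letting
`y → ∞`, then `λ → ∞` (`k(λ,δ) → κ`), then `δ → 0` gives `B → c`.

## References

* H. L. Montgomery, R. C. Vaughan, *Multiplicative Number Theory I. Classical Theory*, CUP 2007,
  §8.3, proof of Thm. 8.6 (the same limsup/liminf sandwich, there with one-sided majorants).
* K. Chandrasekharan, *Introduction to Analytic Number Theory*, Springer 1968, Ch. XI §2,
  Thm. 2 (this step verbatim).
-/

noncomputable section

open Real MeasureTheory Filter Set intervalIntegral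
open scoped Topology

namespace Literature.NumberTheory.LFunctions.WienerIkehara

/-- The shifted kernel integrates over `[y − δ, y + δ]` to `k(λ, δ) = ∫_{-δ}^{δ} K_λ`. [folklore] -/
theorem setIntegral_Icc_fejer_sub (l y δ : ℝ) (hδ : 0 ≤ δ) :
    ∫ u in Icc (y - δ) (y + δ), 2 * l * sinc (l * (y - u)) ^ 2
      = ∫ x in (-δ)..δ, 2 * l * sinc (l * x) ^ 2 := by
  rw [integral_Icc_eq_integral_Ioc, ← intervalIntegral.integral_of_le (by linarith),
    intervalIntegral.integral_comp_sub_left (fun x => 2 * l * sinc (l * x) ^ 2) y]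
  congr 1 <;> ring

/-- The shifted kernel integrates over `ℝ` to `κ = ∫_ℝ K_1`. [folklore] -/
theorem integral_fejer_sub {l : ℝ} (hl : 0 < l) (y : ℝ) :
    ∫ u, 2 * l * sinc (l * (y - u)) ^ 2 = ∫ x : ℝ, 2 * sinc x ^ 2 := by
  rw [← integral_fejer_eq hl]
  exact integral_sub_left_eq_self (fun x => 2 * l * sinc (l * x) ^ 2) volume y

/-- Slow decrease on a window: if `B(v) ≥ e^{u−v} B(u)` for `u ≤ v` and `B ≥ 0`, then for
`u ∈ [y − δ, y + δ]`, `e^{-2δ} B(y − δ) ≤ B(u)`. [folklore] -/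
theorem le_of_slowly_decreasing {B : ℝ → ℝ} (hB0 : ∀ u, 0 ≤ B u)
    (hmono : ∀ u v, u ≤ v → B u * rexp (u - v) ≤ B v) {y δ u : ℝ}
    (hu : u ∈ Icc (y - δ) (y + δ)) : B (y - δ) * rexp (-(2 * δ)) ≤ B u := by
  refine le_trans ?_ (hmono (y - δ) u hu.1)
  gcongr
  · exact hB0 _
  · linarith [hu.2]

/-- Slow decrease on a window, upper form: for `u ∈ [y − δ, y + δ]`, `B(u) ≤ e^{2δ} B(y + δ)`.
[folklore] -/
theorem le_of_slowly_decreasing' {B : ℝ → ℝ} (hB0 : ∀ u, 0 ≤ B u)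
    (hmono : ∀ u v, u ≤ v → B u * rexp (u - v) ≤ B v) {y δ u : ℝ}
    (hu : u ∈ Icc (y - δ) (y + δ)) : B u ≤ B (y + δ) * rexp (2 * δ) := by
  have h1 := hmono u (y + δ) hu.2
  have h2 : B u * rexp (-(2 * δ)) ≤ B u * rexp (u - (y + δ)) := by
    gcongr
    · exact hB0 _
    · linarith [hu.1]
  have h3 : B u * rexp (-(2 * δ)) * rexp (2 * δ) ≤ B (y + δ) * rexp (2 * δ) := by
    gcongr
    exact h2.trans h1
  rwa [mul_assoc, ← Real.exp_add, neg_add_cancel, Real.exp_zero, mul_one] at h3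

/-- Lower bound for the Fejér mean: `e^{-2δ} B(y − δ) k(λ, δ) ≤ ∫ B(u) K_λ(y − u) du`. [folklore] -/
theorem fejerMean_lower {B : ℝ → ℝ} (hB0 : ∀ u, 0 ≤ B u)
    (hmono : ∀ u v, u ≤ v → B u * rexp (u - v) ≤ B v) {l : ℝ} (hl : 0 < l) {δ : ℝ} (hδ : 0 < δ)
    (y : ℝ) (hint : Integrable fun u => B u * (2 * l * sinc (l * (y - u)) ^ 2)) :
    B (y - δ) * rexp (-(2 * δ)) * ∫ x in (-δ)..δ, 2 * l * sinc (l * x) ^ 2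
      ≤ ∫ u, B u * (2 * l * sinc (l * (y - u)) ^ 2) := by
  have hK : Integrable fun u => 2 * l * sinc (l * (y - u)) ^ 2 :=
    (integrable_fejer hl).comp_sub_left y
  calc B (y - δ) * rexp (-(2 * δ)) * ∫ x in (-δ)..δ, 2 * l * sinc (l * x) ^ 2
      = ∫ u in Icc (y - δ) (y + δ), B (y - δ) * rexp (-(2 * δ)) * (2 * l * sinc (l * (y - u)) ^ 2) := by
        rw [MeasureTheory.integral_const_mul, setIntegral_Icc_fejer_sub l y δ hδ.le]
    _ ≤ ∫ u in Icc (y - δ) (y + δ), B u * (2 * l * sinc (l * (y - u)) ^ 2) := by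
        refine setIntegral_mono_on (hK.const_mul _).integrableOn hint.integrableOn
          measurableSet_Icc fun u hu => ?_
        exact mul_le_mul_of_nonneg_right (le_of_slowly_decreasing hB0 hmono hu)
          (fejer_nonneg hl.le _)
    _ ≤ ∫ u, B u * (2 * l * sinc (l * (y - u)) ^ 2) :=
        setIntegral_le_integral hint (Eventually.of_forall fun u =>
          mul_nonneg (hB0 u) (fejer_nonneg hl.le _))

/-- Upper bound for the Fejér mean when `B ≤ M`:
`∫ B(u) K_λ(y − u) du ≤ e^{2δ} B(y + δ) k(λ, δ) + M (κ − k(λ, δ))`. [folklore] -/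
theorem fejerMean_upper {B : ℝ → ℝ} (hB0 : ∀ u, 0 ≤ B u)
    (hmono : ∀ u v, u ≤ v → B u * rexp (u - v) ≤ B v) {M : ℝ} (hM : ∀ u, B u ≤ M)
    {l : ℝ} (hl : 0 < l) {δ : ℝ} (hδ : 0 < δ)
    (y : ℝ) (hint : Integrable fun u => B u * (2 * l * sinc (l * (y - u)) ^ 2)) :
    ∫ u, B u * (2 * l * sinc (l * (y - u)) ^ 2)
      ≤ B (y + δ) * rexp (2 * δ) * (∫ x in (-δ)..δ, 2 * l * sinc (l * x) ^ 2)
        + M * ((∫ x : ℝ, 2 * sinc x ^ 2) - ∫ x in (-δ)..δ, 2 * l * sinc (l * x) ^ 2) := by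
  have hK : Integrable fun u => 2 * l * sinc (l * (y - u)) ^ 2 :=
    (integrable_fejer hl).comp_sub_left y
  have hsplit := integral_add_compl (measurableSet_Icc (a := y - δ) (b := y + δ)) hint
  have hsplitK := integral_add_compl (measurableSet_Icc (a := y - δ) (b := y + δ)) hK
  rw [integral_fejer_sub hl y, setIntegral_Icc_fejer_sub l y δ hδ.le] at hsplitK
  rw [← hsplit]
  gcongr
  · -- window part
    calc ∫ u in Icc (y - δ) (y + δ), B u * (2 * l * sinc (l * (y - u)) ^ 2)
        ≤ ∫ u in Icc (y - δ) (y + δ), B (y + δ) * rexp (2 * δ) * (2 * l * sinc (l * (y - u)) ^ 2) := by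
          refine setIntegral_mono_on hint.integrableOn (hK.const_mul _).integrableOn
            measurableSet_Icc fun u hu => ?_
          exact mul_le_mul_of_nonneg_right (le_of_slowly_decreasing' hB0 hmono hu)
            (fejer_nonneg hl.le _)
      _ = B (y + δ) * rexp (2 * δ) * ∫ x in (-δ)..δ, 2 * l * sinc (l * x) ^ 2 := by
          rw [MeasureTheory.integral_const_mul, setIntegral_Icc_fejer_sub l y δ hδ.le]
  · -- tail part
    calc ∫ u in (Icc (y - δ) (y + δ))ᶜ, B u * (2 * l * sinc (l * (y - u)) ^ 2)
        ≤ ∫ u in (Icc (y - δ) (y + δ))ᶜ, M * (2 * l * sinc (l * (y - u)) ^ 2) := by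
          refine setIntegral_mono_on hint.integrableOn (hK.const_mul _).integrableOn
            measurableSet_Icc.compl fun u _ => ?_
          exact mul_le_mul_of_nonneg_right (hM u) (fejer_nonneg hl.le _)
      _ = M * ((∫ x : ℝ, 2 * sinc x ^ 2) - ∫ x in (-δ)..δ, 2 * l * sinc (l * x) ^ 2) := by
          rw [MeasureTheory.integral_const_mul]
          congr 1
          linarith

/-- **Tauberian step of the Wiener–Ikehara theorem.** Let `B : ℝ → ℝ` be non-negative, bounded
above on every left half-line, and slowly decreasing in the sense `B(v) ≥ e^{u−v} B(u)` for
`u ≤ v`. If for every `λ > 0` the Fejér means `∫ B(u) K_λ(y − u) du` (assumed to exist) tend to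
`c ∫_ℝ K_1` as `y → ∞`, then `B(y) → c`. (Chandrasekharan 1968, Ch. XI §2; the limsup/liminf
sandwich in Montgomery–Vaughan 2007, proof of Thm. 8.6.)
[cite: MontgomeryVaughan2007, §8.3, proof of Thm. 8.6] -/
theorem tendsto_of_tendsto_fejerMean (B : ℝ → ℝ) (c : ℝ) (hB0 : ∀ u, 0 ≤ B u)
    (hmono : ∀ u v, u ≤ v → B u * rexp (u - v) ≤ B v)
    (hbdd : ∀ T : ℝ, ∃ M, ∀ u ≤ T, B u ≤ M)
    (hint : ∀ l : ℝ, 0 < l → ∀ y : ℝ, Integrable fun u => B u * (2 * l * sinc (l * (y - u)) ^ 2))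
    (hlim : ∀ l : ℝ, 0 < l → Tendsto (fun y : ℝ => ∫ u, B u * (2 * l * sinc (l * (y - u)) ^ 2))
      atTop (𝓝 (c * ∫ x : ℝ, 2 * sinc x ^ 2))) :
    Tendsto B atTop (𝓝 c) := by
  set κ : ℝ := ∫ x : ℝ, 2 * sinc x ^ 2 with hκ_def
  have hκ : 0 < κ := by simpa using integral_fejer_pos one_pos
  -- notation for k(l, δ)
  set k : ℝ → ℝ → ℝ := fun l δ => ∫ x in (-δ)..δ, 2 * l * sinc (l * x) ^ 2 with hk_def
  have hk_pos : ∀ {l δ : ℝ}, 0 < l → 0 < δ → 0 < k l δ := fun hl hδ =>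
    intervalIntegral_fejer_pos hl hδ
  have hk_tendsto : ∀ {δ : ℝ}, 0 < δ → Tendsto (fun l => k l δ) atTop (𝓝 κ) := fun hδ =>
    tendsto_intervalIntegral_fejer hδ
  -- c ≥ 0
  have hc : 0 ≤ c := by
    have h1 := hlim 1 one_pos
    have h2 : 0 ≤ c * κ :=
      ge_of_tendsto' h1 fun y => integral_nonneg fun u => mul_nonneg (hB0 u) (fejer_nonneg zero_le_one _)
    nlinarith
  -- Step U: eventually B < t for every t > c
  have hU : ∀ t : ℝ, c < t → ∀ᶠ y in atTop, B y < t := by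
    intro t ht
    -- choose δ with c e^{2δ} < t
    obtain ⟨δ, hδ, hδt⟩ : ∃ δ : ℝ, 0 < δ ∧ c * rexp (2 * δ) < t := by
      have h1 : Tendsto (fun δ : ℝ => c * rexp (2 * δ)) (𝓝[>] 0) (𝓝 (c * rexp (2 * 0))) :=
        ((by fun_prop : Continuous fun δ : ℝ => c * rexp (2 * δ)).tendsto 0).mono_left
          nhdsWithin_le_nhds
      simp only [mul_zero, Real.exp_zero, mul_one] at h1
      exact ((h1.eventually (gt_mem_nhds ht)).and self_mem_nhdsWithin).exists.imp
        fun δ h => ⟨h.2, h.1⟩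
    -- choose l with c κ e^{2δ} / k(l,δ) < t
    obtain ⟨l, hl, hlt⟩ : ∃ l : ℝ, 0 < l ∧ c * κ * rexp (2 * δ) / k l δ < t := by
      have h1 : Tendsto (fun l => c * κ * rexp (2 * δ) / k l δ) atTop
          (𝓝 (c * κ * rexp (2 * δ) / κ)) :=
        Tendsto.div tendsto_const_nhds (hk_tendsto hδ) hκ.ne'
      rw [show c * κ * rexp (2 * δ) / κ = c * rexp (2 * δ) by field_simp] at h1
      exact ((h1.eventually (gt_mem_nhds hδt)).and (eventually_gt_atTop 0)).exists.imp
        fun l h => ⟨h.2, h.1⟩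
    -- eventually Φ_l(y) e^{2δ}/k < t, hence B(y - δ) < t
    have h2 : Tendsto (fun y => (∫ u, B u * (2 * l * sinc (l * (y - u)) ^ 2)) * rexp (2 * δ) / k l δ)
        atTop (𝓝 (c * κ * rexp (2 * δ) / k l δ)) :=
      ((hlim l hl).mul_const _).div_const _
    have h3 : ∀ᶠ y in atTop, B (y - δ) < t := by
      filter_upwards [h2.eventually (gt_mem_nhds hlt)] with y hy
      refine lt_of_le_of_lt ?_ hy
      rw [le_div_iff₀ (hk_pos hl hδ)]
      have := fejerMean_lower hB0 hmono hl hδ y (hint l hl y)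
      have hexp : rexp (-(2 * δ)) * rexp (2 * δ) = 1 := by
        rw [← Real.exp_add, neg_add_cancel, Real.exp_zero]
      calc B (y - δ) * k l δ = B (y - δ) * rexp (-(2 * δ)) * k l δ * rexp (2 * δ) := by
            rw [show B (y - δ) * rexp (-(2 * δ)) * k l δ * rexp (2 * δ)
              = B (y - δ) * k l δ * (rexp (-(2 * δ)) * rexp (2 * δ)) by ring, hexp, mul_one]
        _ ≤ (∫ u, B u * (2 * l * sinc (l * (y - u)) ^ 2)) * rexp (2 * δ) := by
            gcongr
    -- shift
    have h4 := (tendsto_atTop_add_const_right atTop δ tendsto_id).eventually h3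
    simpa using h4
  -- global bound
  obtain ⟨M, hM0, hM⟩ : ∃ M : ℝ, 0 ≤ M ∧ ∀ u, B u ≤ M := by
    obtain ⟨Y, hY⟩ := (hU (c + 1) (by linarith)).exists_forall_of_atTop
    obtain ⟨M₀, hM₀⟩ := hbdd Y
    refine ⟨max (max (c + 1) M₀) 0, le_max_right _ _, fun u => ?_⟩
    rcases le_or_gt u Y with h | h
    · exact (hM₀ u h).trans ((le_max_right _ _).trans (le_max_left _ _))
    · exact (hY u h.le).le.trans ((le_max_left _ _).trans (le_max_left _ _))
  -- Step L: eventually B > t for every t < c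
  have hL : ∀ t : ℝ, t < c → ∀ᶠ y in atTop, t < B y := by
    intro t ht
    obtain ⟨δ, hδ, hδt⟩ : ∃ δ : ℝ, 0 < δ ∧ t < c * rexp (-(2 * δ)) := by
      have h1 : Tendsto (fun δ : ℝ => c * rexp (-(2 * δ))) (𝓝[>] 0) (𝓝 (c * rexp (-(2 * 0)))) :=
        ((by fun_prop : Continuous fun δ : ℝ => c * rexp (-(2 * δ))).tendsto 0).mono_left
          nhdsWithin_le_nhds
      simp only [mul_zero, neg_zero, Real.exp_zero, mul_one] at h1
      exact ((h1.eventually (lt_mem_nhds ht)).and self_mem_nhdsWithin).exists.imp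
        fun δ h => ⟨h.2, h.1⟩
    -- L(l, δ) := (c κ − M (κ − k)) e^{-2δ} / k → c e^{-2δ} as l → ∞
    obtain ⟨l, hl, hlt⟩ : ∃ l : ℝ, 0 < l ∧
        t < (c * κ - M * (κ - k l δ)) * rexp (-(2 * δ)) / k l δ := by
      have h1 : Tendsto (fun l => (c * κ - M * (κ - k l δ)) * rexp (-(2 * δ)) / k l δ) atTop
          (𝓝 ((c * κ - M * (κ - κ)) * rexp (-(2 * δ)) / κ)) := by
        refine Tendsto.div (Tendsto.mul_const _ ?_) (hk_tendsto hδ) hκ.ne'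
        exact tendsto_const_nhds.sub (tendsto_const_nhds.mul (tendsto_const_nhds.sub (hk_tendsto hδ)))
      rw [show (c * κ - M * (κ - κ)) * rexp (-(2 * δ)) / κ = c * rexp (-(2 * δ)) by
        field_simp; ring] at h1
      exact ((h1.eventually (lt_mem_nhds hδt)).and (eventually_gt_atTop 0)).exists.imp
        fun l h => ⟨h.2, h.1⟩
    have h2 : Tendsto (fun y => ((∫ u, B u * (2 * l * sinc (l * (y - u)) ^ 2))
        - M * (κ - k l δ)) * rexp (-(2 * δ)) / k l δ)
        atTop (𝓝 ((c * κ - M * (κ - k l δ)) * rexp (-(2 * δ)) / k l δ)) :=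
      (((hlim l hl).sub_const _).mul_const _).div_const _
    have h3 : ∀ᶠ y in atTop, t < B (y + δ) := by
      filter_upwards [h2.eventually (lt_mem_nhds hlt)] with y hy
      refine lt_of_lt_of_le hy ?_
      rw [div_le_iff₀ (hk_pos hl hδ)]
      have := fejerMean_upper hB0 hmono hM hl hδ y (hint l hl y)
      have hexp : rexp (2 * δ) * rexp (-(2 * δ)) = 1 := by
        rw [← Real.exp_add, add_neg_cancel, Real.exp_zero]
      calc ((∫ u, B u * (2 * l * sinc (l * (y - u)) ^ 2)) - M * (κ - k l δ)) * rexp (-(2 * δ))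
          ≤ (B (y + δ) * rexp (2 * δ) * k l δ) * rexp (-(2 * δ)) := by
            gcongr
            linarith
        _ = B (y + δ) * k l δ := by
            rw [show B (y + δ) * rexp (2 * δ) * k l δ * rexp (-(2 * δ))
              = B (y + δ) * k l δ * (rexp (2 * δ) * rexp (-(2 * δ))) by ring, hexp, mul_one]
    have h4 := (tendsto_atTop_add_const_right atTop (-δ) tendsto_id).eventually h3
    simpa using h4
  exact tendsto_order.2 ⟨hL, hU⟩

end Literature.NumberTheory.LFunctions.WienerIkehara

end
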